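/-
Copyright (c) 2026 the pub-hodgecm-mathlib formalisation cell (harness21).  Prover seat hodgecm-mathlib-K2E1-p12 (g2), Track B ∕ K2-LIT, h413 = `stmt-HodgeConjecture-24833`,
line `K2_E1_TraceFormulaBeta`, dealer K2E1-plan (g7) (232)∕(238)∕(241) «F3d-α», file α-2b (assembly): the isotypic decomposition of a left-`N(𝔸)B(F)`-invariant, right-`K'`-invariant
continuous family in a height band on `U(1,1)(𝔸_F)` under the compact group `C_E¹` — the binder `hα` of ★ p860399 `K2E1PseudoEisensteinFamilyDecompositionU2` (K2E1-p10 (g2)).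
-/
import Summits.HodgeConjecture.HodgeConjecture.Theorems.K2E1NormOneTorusFamilyActionU2        -- ★ α-1: `σ`, the kernel `Φ` on `C_E × G`, Borel transport, compact shells
import Summits.HodgeConjecture.HodgeConjecture.Theorems.K2E1CompactAbelianFamilyApproximationU  -- ★ α-2a: Fejér for equicontinuous bounded families (+ ★ F3c tube lemma)
import HarnessLib

/-!
# K2·E1 — `K2E1NormOneTorusFamilyApproxU2` (F3d-α, file α-2b): ISOTYPIC DECOMPOSITION UNDER `C_E¹` of band-limited left-`N(𝔸)B(F)`-invariant families on `U(1,1)(𝔸_F)`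

Track B ∕ K2-LIT, crux h413 = `stmt-HodgeConjecture-24833`, route `HCCMUnconditional`; cell `hodgecm-mathlib`, squad K2, ENGINE E1, ROADCARD C7 «families»; consumer K2E1-p10 (g2)'s
★ p860399 binder `hα` (bus `K2/STATUS.md` 2026-09-04T13:07:18Z: clause ORDER verbatim).  THEOREMS ONLY (no `def`, no `instance`, no notation, no named-fact hypothesis, no `sorry`);
lane `--supports stmt-HodgeConjecture-24833 --as helper` (count-neutral).  Closes no socket.  Generic quasi-split pair `(F, E, c)` with `c² = 1`, rank `2` (the CM pair is an instance).

THE MATHEMATICS ([MoeglinWaldspurger1995, §II.1.3, §II.1.10]; [Garrett2018, §2.10–§2.11]; [DeitmarEchterhoff2014, Prop. 3.5.2]).  Let `ψ : G → ℂ` be continuous, left-`N(𝔸_F)`- and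
left-`B(F)`-invariant, right-`K'`-invariant, supported in the height band `a ≤ H ≤ b` (`0 < a`), with `G = B(𝔸_F)·W·K'` for a finite `W`.  By ★ α-1, `Φ(c, g) = ψ(σ(x) g)` (`c = [x]`)
is a jointly continuous kernel on `C_E × G` with `Φ(c, b g) = Φ(c [b₀₀], g)` and compact support in `c` for each `g`; through `g = β w k` every section `Φ(·, g)` is a TRANSLATE of one
of the finitely many compactly supported `Φ(·, w)`, so the family is uniformly bounded (§2) and EQUICONTINUOUS under `C_E¹` (§1, generalized tube lemma ★ F3c).  For a unitary
character `χ₀` of the compact abelian group `C_E¹` (★ α-0) put `P_{χ₀}(g) := ∫_{C_E¹} χ̄₀(c) Φ(c, g) dc` (normalised Haar): continuous in `g`, right-`K'`- and left-`B(F)`-invariant,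
`P(b g) = χ₀([b₀₀]) P(g)` for NORM-ONE `b ∈ B(𝔸_F)`, supported in the band, bounded (§3).  ★ α-2a (Fejér for families) gives ONE finite set of characters and coefficients with
`‖ψ(g) − Σ a_{χ₀} P_{χ₀}(g)‖ ≤ ε` for all `g`; the dictionary ★ α-0 `χ₀ ↦ χ` (Hecke characters trivial on the archimedean ray with `χ = χ₀` on norm-one ideles) re-indexes the sum by
Hecke characters (§4 HEAD, in K2E1-p10 (g2)'s `hα` clause order).
* §1 `exists_isOpen_forall_kernel_sub_le` · §2 `exists_forall_norm_kernel_le`, `kernel_one_eq` · §3 `continuous_isotypicU`, `isotypicU_borel_mul_of_norm_eq_one`, `band_of_isotypicU_ne_zero`,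
  `norm_isotypicU_le` · §4 HEAD **`exists_finset_heckeCharacter_family_decomposition`**.
HONEST LABEL: HC_CM is proved only modulo the 7 printed citations (2 remaining named inputs: hLiu418 = `stmt-HodgeConjecture-24832`, h413 = `stmt-HodgeConjecture-24833`) until rung 0
closes; this file is letter-free and closes no socket.
References: [MoeglinWaldspurger1995] §II.1.3, §II.1.10 · [Garrett2018] §2.10–§2.11 · [DeitmarEchterhoff2014] Prop. 3.5.2 · [WeilBNT1967] Ch. IV §4.
-/

set_option autoImplicit false
-- the mandated namespace repeats the single-problem summit's segment (`HodgeConjecture.HodgeConjecture`)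
set_option linter.dupNamespace false

noncomputable section

open NumberField IsDedekindDomain Set Filter Topology Function MeasureTheory
open scoped NNReal
open Literature.NumberTheory.Automorphic Literature.NumberTheory.Automorphic.UnitaryGroup Literature.NumberTheory.GaloisRepresentations
open Summit.HodgeConjecture.HodgeConjecture.Cruxes.H413.K2E1CharacterEisensteinU2Defs Summit.HodgeConjecture.HodgeConjecture.Cruxes.H413.K2E1NormOneIdeleClassRetractionU
  Summit.HodgeConjecture.HodgeConjecture.Cruxes.H413.K2E1NormOneTorusFamilyActionU2 Summit.HodgeConjecture.HodgeConjecture.Cruxes.H413.K2E1CompactAbelianIsotypicApproximationU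
  Summit.HodgeConjecture.HodgeConjecture.Cruxes.H413.K2E1CompactAbelianFamilyApproximationU

namespace Summit.HodgeConjecture.HodgeConjecture.Cruxes.H413.K2E1NormOneTorusFamilyApproxU2

variable {F E : Type} [Field F] [NumberField F] [Field E] [NumberField E] [Algebra F E] {c : E ≃ₐ[F] E}

/-! ## §1 Equicontinuity of the family `{Φ(·, g)}_g` under the norm-one classes -/

/-- **EQUICONTINUITY.**  With `G = B(𝔸_F)·W·K'` (`W` finite), `ψ` right-`K'`-invariant and band-limited (`0 < a`): for `ε > 0` there is an open `u ∋ 1` in `C_E¹` with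
`‖Φ(v·y, g) − Φ(y, g)‖ ≤ ε` for all `v ∈ u`, ALL `y ∈ C_E` and ALL `g` (each `Φ(·, g)` is a translate of one of the finitely many compactly supported `Φ(·, w)`; generalized tube lemma ★ F3c).
[cite: MoeglinWaldspurger1995, §II.1.3] -/
theorem exists_isOpen_forall_kernel_sub_le {ψ : (quasiSplit F E c 2).Adelic → ℂ}
    (hψU : ∀ (u : adelicUnipotent F E c 2) (g : (quasiSplit F E c 2).Adelic), ψ ((u : (quasiSplit F E c 2).Adelic) * g) = ψ g)
    {K' : Subgroup (quasiSplit F E c 2).Adelic} (hψK : ∀ (g : (quasiSplit F E c 2).Adelic) (k : K'), ψ (g * (k : (quasiSplit F E c 2).Adelic)) = ψ g)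
    {a b : ℝ≥0} (ha : 0 < a) (hband : ∀ g, ψ g ≠ 0 → a ≤ borelHeight g ∧ borelHeight g ≤ b)
    (hBK : ∃ W : Finset (quasiSplit F E c 2).Adelic, ∀ g, ∃ β ∈ borelAdelic F E c 2, ∃ w ∈ W, ∃ k ∈ K', g = β * w * k)
    {σ : ideleGroup E → ↥(torusInBorel F E c 2)} (hσm : ∀ x y, σ (x * y) = σ x * σ y) (hσ₀ : ∀ x, firstEntryUnit (σ x).1.2 = x)
    (hσt : ∀ t : ↥(torusInBorel F E c 2), σ (firstEntryUnit t.1.2) = t)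
    {Φ : IdeleClassGroup E → (quasiSplit F E c 2).Adelic → ℂ} (hΦ : ∀ (x : ideleGroup E) (g : (quasiSplit F E c 2).Adelic), Φ (x : IdeleClassGroup E) g = ψ ((σ x).1.1 * g))
    (hΦc : Continuous (uncurry Φ)) {ε : ℝ} (hε : 0 < ε) :
    ∃ u : Set ↥(IdeleClassGroup.normOne E), IsOpen u ∧ (1 : ↥(IdeleClassGroup.normOne E)) ∈ u ∧
      ∀ v ∈ u, ∀ (y : IdeleClassGroup E) (g : (quasiSplit F E c 2).Adelic), ‖Φ ((v : IdeleClassGroup E) * y) g - Φ y g‖ ≤ ε := by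
  classical
  haveI : T2Space (IdeleClassGroup E) := IdeleClassGroup.t2Space_ideleClassGroup_holds E
  haveI : CompactSpace ↥(IdeleClassGroup.normOne E) := compactSpace_normOne E
  obtain ⟨W, hW⟩ := hBK
  -- each section `Φ(·, w)` is continuous with compact support
  have hcw : ∀ w : (quasiSplit F E c 2).Adelic, Continuous fun y : IdeleClassGroup E => Φ y w := fun w => hΦc.comp (continuous_id.prodMk continuous_const)
  have hsw : ∀ w : (quasiSplit F E c 2).Adelic, HasCompactSupport fun y : IdeleClassGroup E => Φ y w := fun w => by
    obtain ⟨S, hS, hS0⟩ := exists_isCompact_kernel_eq_zero ha hband hσ₀ hΦ w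
    exact HasCompactSupport.intro hS hS0
  -- tube lemma for each `w`, intersected over the finite `W`
  choose uw huw h1uw hUw using fun w : (quasiSplit F E c 2).Adelic =>
    exists_nhds_one_forall_norm_sub_le (C := ↥(IdeleClassGroup.normOne E)) (hcw w) (hsw w) hε
  refine ⟨⋂ w ∈ W, uw w, isOpen_biInter_finset fun w _ => huw w, mem_iInter₂.2 fun w _ => h1uw w, fun v hv y g => ?_⟩
  obtain ⟨β, hβ, w, hwW, k, hk, rfl⟩ := hW g
  have hv' : v ∈ uw w := mem_iInter₂.1 hv w hwW
  have hk' : ∀ h : (quasiSplit F E c 2).Adelic, ψ (h * k) = ψ h := fun h => hψK h ⟨k, hk⟩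
  rw [kernel_mul_right hΦ hk', kernel_mul_right hΦ hk', kernel_borel_mul hψU hσm hσt hΦ _ hβ, kernel_borel_mul hψU hσm hσt hΦ _ hβ, mul_assoc]
  exact hUw w v hv' (y * (firstEntryUnit hβ : IdeleClassGroup E))

/-! ## §2 A uniform bound, and `Φ(1, g) = ψ(g)` -/

/-- **UNIFORM BOUND**: `‖Φ(y, g)‖ ≤ M` for all `y, g` (finitely many compactly supported continuous sections up to translation). [cite: MoeglinWaldspurger1995, §II.1.3] -/
theorem exists_forall_norm_kernel_le {ψ : (quasiSplit F E c 2).Adelic → ℂ}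
    (hψU : ∀ (u : adelicUnipotent F E c 2) (g : (quasiSplit F E c 2).Adelic), ψ ((u : (quasiSplit F E c 2).Adelic) * g) = ψ g)
    {K' : Subgroup (quasiSplit F E c 2).Adelic} (hψK : ∀ (g : (quasiSplit F E c 2).Adelic) (k : K'), ψ (g * (k : (quasiSplit F E c 2).Adelic)) = ψ g)
    {a b : ℝ≥0} (ha : 0 < a) (hband : ∀ g, ψ g ≠ 0 → a ≤ borelHeight g ∧ borelHeight g ≤ b)
    (hBK : ∃ W : Finset (quasiSplit F E c 2).Adelic, ∀ g, ∃ β ∈ borelAdelic F E c 2, ∃ w ∈ W, ∃ k ∈ K', g = β * w * k)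
    {σ : ideleGroup E → ↥(torusInBorel F E c 2)} (hσm : ∀ x y, σ (x * y) = σ x * σ y) (hσ₀ : ∀ x, firstEntryUnit (σ x).1.2 = x)
    (hσt : ∀ t : ↥(torusInBorel F E c 2), σ (firstEntryUnit t.1.2) = t)
    {Φ : IdeleClassGroup E → (quasiSplit F E c 2).Adelic → ℂ} (hΦ : ∀ (x : ideleGroup E) (g : (quasiSplit F E c 2).Adelic), Φ (x : IdeleClassGroup E) g = ψ ((σ x).1.1 * g))
    (hΦc : Continuous (uncurry Φ)) :
    ∃ M : ℝ, ∀ (y : IdeleClassGroup E) (g : (quasiSplit F E c 2).Adelic), ‖Φ y g‖ ≤ M := by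
  classical
  haveI : T2Space (IdeleClassGroup E) := IdeleClassGroup.t2Space_ideleClassGroup_holds E
  obtain ⟨W, hW⟩ := hBK
  have hcw : ∀ w : (quasiSplit F E c 2).Adelic, Continuous fun y : IdeleClassGroup E => Φ y w := fun w => hΦc.comp (continuous_id.prodMk continuous_const)
  have hsw : ∀ w : (quasiSplit F E c 2).Adelic, HasCompactSupport fun y : IdeleClassGroup E => Φ y w := fun w => by
    obtain ⟨S, hS, hS0⟩ := exists_isCompact_kernel_eq_zero ha hband hσ₀ hΦ w
    exact HasCompactSupport.intro hS hS0
  choose Mw hMw using fun w : (quasiSplit F E c 2).Adelic => (hcw w).bounded_above_of_compact_support (hsw w)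
  refine ⟨∑ w ∈ W, max (Mw w) 0, fun y g => ?_⟩
  obtain ⟨β, hβ, w, hwW, k, hk, rfl⟩ := hW g
  have hk' : ∀ h : (quasiSplit F E c 2).Adelic, ψ (h * k) = ψ h := fun h => hψK h ⟨k, hk⟩
  rw [kernel_mul_right hΦ hk', kernel_borel_mul hψU hσm hσt hΦ _ hβ]
  exact ((hMw w _).trans (le_max_left _ _)).trans (Finset.single_le_sum (fun w' _ => le_max_right (Mw w') 0) hwW)

/-- `σ(1) = 1`, so `Φ(1, g) = ψ(g)`. [cite: MoeglinWaldspurger1995, §II.1.3] -/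
theorem kernel_one_eq {M : Type*} {ψ : (quasiSplit F E c 2).Adelic → M} {σ : ideleGroup E → ↥(torusInBorel F E c 2)} (hσm : ∀ x y, σ (x * y) = σ x * σ y)
    {Φ : IdeleClassGroup E → (quasiSplit F E c 2).Adelic → M} (hΦ : ∀ (x : ideleGroup E) (g : (quasiSplit F E c 2).Adelic), Φ (x : IdeleClassGroup E) g = ψ ((σ x).1.1 * g))
    (g : (quasiSplit F E c 2).Adelic) : Φ 1 g = ψ g := by
  have h1 : σ 1 = 1 := by
    have h := hσm 1 1
    rw [mul_one] at h
    exact (mul_eq_left.1 h.symm)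
  rw [← QuotientGroup.mk_one, hΦ, h1]
  simp only [OneMemClass.coe_one, one_mul]

/-! ## §3 The isotypic pieces `P_{χ₀}(g) = ∫_{C_E¹} χ̄₀(v) Φ(v, g) dv` -/

/-- **Continuity of `P_{χ₀}` in `g`** (jointly continuous integrand over the compact `C_E¹`; `G` is locally compact and second countable). [cite: MoeglinWaldspurger1995, §II.1.10] -/
theorem continuous_isotypicU [MeasurableSpace ↥(IdeleClassGroup.normOne E)] [BorelSpace ↥(IdeleClassGroup.normOne E)] (μC : Measure ↥(IdeleClassGroup.normOne E))
    [IsProbabilityMeasure μC] {Φ : IdeleClassGroup E → (quasiSplit F E c 2).Adelic → ℂ} (hΦc : Continuous (uncurry Φ)) (χ₀ : PontryaginDual ↥(IdeleClassGroup.normOne E)) :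
    Continuous fun g : (quasiSplit F E c 2).Adelic => ∫ v, star ((χ₀ v : Circle) : ℂ) * Φ (v : IdeleClassGroup E) g ∂μC := by
  haveI : T2Space (IdeleClassGroup E) := IdeleClassGroup.t2Space_ideleClassGroup_holds E
  haveI : CompactSpace ↥(IdeleClassGroup.normOne E) := compactSpace_normOne E
  haveI : LocallyCompactSpace (quasiSplit F E c 2).Adelic := locallyCompactSpace_quasiSplitAdelic
  haveI : SecondCountableTopology (quasiSplit F E c 2).Adelic := secondCountableTopology_quasiSplitAdelic
  have hf : Continuous (uncurry fun (g : (quasiSplit F E c 2).Adelic) (v : ↥(IdeleClassGroup.normOne E)) => star ((χ₀ v : Circle) : ℂ) * Φ (v : IdeleClassGroup E) g) :=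
    (continuous_star.comp (continuous_subtype_val.comp ((map_continuous χ₀).comp continuous_snd))).mul
      (hΦc.comp ((continuous_subtype_val.comp continuous_snd).prodMk continuous_fst))
  have h := continuous_parametric_integral_of_continuous (μ := μC) hf isCompact_univ
  simpa only [Measure.restrict_univ] using h

/-- **Isotypy under `C_E¹`**: `∫ χ̄₀(v) Φ(v·v₀, g) dv = χ₀(v₀) ∫ χ̄₀(v) Φ(v, g) dv` (left-invariance of `μC`, commutativity, `χ̄₀(v₀⁻¹ d) = χ₀(v₀) χ̄₀(d)`).
[cite: DeitmarEchterhoff2014, Prop. 3.5.2] -/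
theorem isotypicU_mul_normOne [MeasurableSpace ↥(IdeleClassGroup.normOne E)] [BorelSpace ↥(IdeleClassGroup.normOne E)] (μC : Measure ↥(IdeleClassGroup.normOne E))
    [μC.IsMulLeftInvariant]
    (Φ : IdeleClassGroup E → (quasiSplit F E c 2).Adelic → ℂ) (χ₀ : PontryaginDual ↥(IdeleClassGroup.normOne E)) (v₀ : ↥(IdeleClassGroup.normOne E))
    (g : (quasiSplit F E c 2).Adelic) :
    ∫ v, star ((χ₀ v : Circle) : ℂ) * Φ ((v : IdeleClassGroup E) * (v₀ : IdeleClassGroup E)) g ∂μC =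
      ((χ₀ v₀ : Circle) : ℂ) * ∫ v, star ((χ₀ v : Circle) : ℂ) * Φ (v : IdeleClassGroup E) g ∂μC := by
  have h1 : (fun v : ↥(IdeleClassGroup.normOne E) => star ((χ₀ v : Circle) : ℂ) * Φ ((v : IdeleClassGroup E) * (v₀ : IdeleClassGroup E)) g) =
      fun v => (fun d : ↥(IdeleClassGroup.normOne E) => star ((χ₀ (v₀⁻¹ * d) : Circle) : ℂ) * Φ (d : IdeleClassGroup E) g) (v₀ * v) := by
    funext v
    show _ = star ((χ₀ (v₀⁻¹ * (v₀ * v)) : Circle) : ℂ) * Φ (((v₀ * v : ↥(IdeleClassGroup.normOne E))) : IdeleClassGroup E) g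
    rw [inv_mul_cancel_left, Subgroup.coe_mul, mul_comm (v₀ : IdeleClassGroup E)]
  rw [h1, integral_mul_left_eq_self (fun d : ↥(IdeleClassGroup.normOne E) => star ((χ₀ (v₀⁻¹ * d) : Circle) : ℂ) * Φ (d : IdeleClassGroup E) g) v₀]
  have h2 : ∀ d, star ((χ₀ (v₀⁻¹ * d) : Circle) : ℂ) = ((χ₀ v₀ : Circle) : ℂ) * star ((χ₀ d : Circle) : ℂ) := fun d => by
    rw [map_mul, map_inv, Circle.coe_mul, star_mul', Circle.coe_inv_eq_conj, Complex.star_def, Complex.conj_conj, mul_comm]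
  simp_rw [h2, mul_assoc]
  exact integral_const_mul _ _

/-- If `P_{χ₀}(g) ≠ 0` then some `Φ(v, g) ≠ 0` (`v ∈ C_E¹`). [folklore] -/
theorem exists_kernel_ne_zero_of_isotypicU_ne_zero [MeasurableSpace ↥(IdeleClassGroup.normOne E)] (μC : Measure ↥(IdeleClassGroup.normOne E))
    {Φ : IdeleClassGroup E → (quasiSplit F E c 2).Adelic → ℂ} {χ₀ : PontryaginDual ↥(IdeleClassGroup.normOne E)} {g : (quasiSplit F E c 2).Adelic}
    (h : ∫ v, star ((χ₀ v : Circle) : ℂ) * Φ (v : IdeleClassGroup E) g ∂μC ≠ 0) : ∃ v : ↥(IdeleClassGroup.normOne E), Φ (v : IdeleClassGroup E) g ≠ 0 := by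
  by_contra hall
  simp only [not_exists, not_not] at hall
  apply h
  simp_rw [hall, mul_zero]
  exact integral_zero _ _

/-- **Bound**: `‖Φ‖ ≤ M ⇒ ‖P_{χ₀}(g)‖ ≤ M` (probability measure, `|χ₀| = 1`). [folklore] -/
theorem norm_isotypicU_le [MeasurableSpace ↥(IdeleClassGroup.normOne E)] (μC : Measure ↥(IdeleClassGroup.normOne E)) [IsProbabilityMeasure μC]
    {Φ : IdeleClassGroup E → (quasiSplit F E c 2).Adelic → ℂ} {M : ℝ} (hM : ∀ y g, ‖Φ y g‖ ≤ M) (χ₀ : PontryaginDual ↥(IdeleClassGroup.normOne E))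
    (g : (quasiSplit F E c 2).Adelic) : ‖∫ v, star ((χ₀ v : Circle) : ℂ) * Φ (v : IdeleClassGroup E) g ∂μC‖ ≤ M := by
  calc ‖∫ v, star ((χ₀ v : Circle) : ℂ) * Φ (v : IdeleClassGroup E) g ∂μC‖ ≤ M * μC.real Set.univ :=
        norm_integral_le_of_norm_le_const (Filter.Eventually.of_forall fun v => by
          rw [norm_mul, norm_star, Circle.norm_coe, one_mul]; exact hM _ _)
    _ = M := by rw [probReal_univ, mul_one]

/-! ## §4 HEAD: the isotypic decomposition, indexed by Hecke characters trivial on the archimedean ray (K2E1-p10 (g2)'s `hα`, clause order verbatim) -/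

/-- **ISOTYPIC DECOMPOSITION UNDER `C_E¹` OF A BAND-LIMITED LEFT-`N(𝔸)B(F)`-INVARIANT FAMILY ON `U(1,1)(𝔸_F)`** (`c² = 1`, `G = B(𝔸_F)·W·K'` with `W` finite).  For `ψ : G → ℂ`
continuous, left-`N(𝔸_F)`-invariant, left-`B(F)`-invariant, right-`K'`-invariant, supported in the height band `[a, b]` with `0 < a`, and `ε > 0`: there are finitely many Hecke
characters `χ` of `E` TRIVIAL ON THE ARCHIMEDEAN RAY, coefficients, and functions `P_χ : G → ℂ` — continuous, right-`K'`-invariant, left-`B(F)`-invariant, `χ`-ISOTYPIC under norm-one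
Borel translations (`P_χ(b g) = χ(b₀₀) P_χ(g)` when `‖b₀₀‖ = 1`), supported in the same band, bounded — with `‖ψ(g) − Σ_χ coef χ · P_χ(g)‖ ≤ ε` for all `g`.  (`P_χ = ∫_{C_E¹} χ̄₀ Φ(·, g)`,
★ α-1 kernel, ★ α-2a Fejér for families, ★ α-0 dictionary `χ₀ ↦ χ`.) [cite: MoeglinWaldspurger1995, §II.1.3, §II.1.10] [cite: DeitmarEchterhoff2014, Prop. 3.5.2] -/
theorem exists_finset_heckeCharacter_family_decomposition (hc : c * c = 1) {K' : Subgroup (quasiSplit F E c 2).Adelic}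
    (hBK : ∃ W : Finset (quasiSplit F E c 2).Adelic, ∀ g, ∃ β ∈ borelAdelic F E c 2, ∃ w ∈ W, ∃ k ∈ K', g = β * w * k)
    (ψ : (quasiSplit F E c 2).Adelic → ℂ) (hψc : Continuous ψ)
    (hψU : ∀ (u : adelicUnipotent F E c 2) (g : (quasiSplit F E c 2).Adelic), ψ ((u : (quasiSplit F E c 2).Adelic) * g) = ψ g)
    (hψB : ∀ b ∈ arithmeticBorel F E c 2, ∀ g : (quasiSplit F E c 2).Adelic, ψ ((b : (quasiSplit F E c 2).Adelic) * g) = ψ g)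
    (hψK : ∀ (g : (quasiSplit F E c 2).Adelic) (k : K'), ψ (g * (k : (quasiSplit F E c 2).Adelic)) = ψ g)
    {a b : ℝ≥0} (ha : 0 < a) (hband : ∀ g, ψ g ≠ 0 → a ≤ borelHeight g ∧ borelHeight g ≤ b) (ε : ℝ) (hε : 0 < ε) :
    ∃ (s : Finset (HeckeCharacter E)) (coef : HeckeCharacter E → ℂ) (P : HeckeCharacter E → (quasiSplit F E c 2).Adelic → ℂ),
      (∀ χ ∈ s, (∀ r : ℝ≥0ˣ, χ (posRealIdele E r) = 1) ∧ Continuous (P χ) ∧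
        (∀ (g : (quasiSplit F E c 2).Adelic) (k : K'), P χ (g * (k : (quasiSplit F E c 2).Adelic)) = P χ g) ∧
        (∀ b ∈ arithmeticBorel F E c 2, ∀ g : (quasiSplit F E c 2).Adelic, P χ ((b : (quasiSplit F E c 2).Adelic) * g) = P χ g) ∧
        (∀ (b : (quasiSplit F E c 2).Adelic) (hb : b ∈ borelAdelic F E c 2), IdeleClassGroup.ideleNorm E (firstEntryUnit hb) = 1 →
          ∀ g : (quasiSplit F E c 2).Adelic, P χ (b * g) = ((χ (firstEntryUnit hb) : ℂˣ) : ℂ) * P χ g) ∧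
        (∀ g, P χ g ≠ 0 → a ≤ borelHeight g ∧ borelHeight g ≤ b) ∧ (∃ M : ℝ, ∀ g, ‖P χ g‖ ≤ M)) ∧
      ∀ g, ‖ψ g - ∑ χ ∈ s, coef χ * P χ g‖ ≤ ε := by
  classical
  haveI : T2Space (IdeleClassGroup E) := IdeleClassGroup.t2Space_ideleClassGroup_holds E
  haveI : CompactSpace ↥(IdeleClassGroup.normOne E) := compactSpace_normOne E
  letI : MeasurableSpace ↥(IdeleClassGroup.normOne E) := borel _
  haveI : BorelSpace ↥(IdeleClassGroup.normOne E) := ⟨rfl⟩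
  set μC : Measure ↥(IdeleClassGroup.normOne E) := Measure.haarMeasure ⊤ with hμC
  haveI : IsProbabilityMeasure μC :=
    ⟨by rw [hμC, ← TopologicalSpace.PositiveCompacts.coe_top]; exact Measure.haarMeasure_self⟩
  -- the section and the kernel (★ α-1)
  obtain ⟨σ, hσc, hσm, hσ₀, hσt⟩ := exists_torusSection_two (F := F) (E := E) (c := c) hc
  obtain ⟨Φ, hΦ, hΦc⟩ := exists_kernel hc hψc hψU hψB hσc hσm hσt
  -- equicontinuity and a uniform bound (§1–§2)
  obtain ⟨u, hu, h1u, hU⟩ := exists_isOpen_forall_kernel_sub_le hψU hψK ha hband hBK hσm hσ₀ hσt hΦ hΦc (half_pos hε)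
  obtain ⟨M, hM⟩ := exists_forall_norm_kernel_le hψU hψK ha hband hBK hσm hσ₀ hσt hΦ hΦc
  -- Fejér for the family `(v, g) ↦ Φ(v, g)` on the compact abelian group `C_E¹` (★ α-2a)
  have hΦv : ∀ g : (quasiSplit F E c 2).Adelic, Continuous fun v : ↥(IdeleClassGroup.normOne E) => Φ (v : IdeleClassGroup E) g := fun g =>
    hΦc.comp (continuous_subtype_val.prodMk continuous_const)
  have hU1 : ∀ v ∈ u, ∀ g : (quasiSplit F E c 2).Adelic,
      ‖Φ (v : IdeleClassGroup E) g - Φ ((1 : ↥(IdeleClassGroup.normOne E)) : IdeleClassGroup E) g‖ ≤ ε / 2 := fun v hv g => by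
    have h := hU v hv ((1 : ↥(IdeleClassGroup.normOne E)) : IdeleClassGroup E) g
    rwa [← Subgroup.coe_mul, mul_one] at h
  obtain ⟨s₀, a₀, happrox⟩ := exists_finset_character_family_approx μC (Φ := fun (v : ↥(IdeleClassGroup.normOne E)) (g : (quasiSplit F E c 2).Adelic) => Φ (v : IdeleClassGroup E) g)
    hΦv (fun v g => hM _ g) hε hu h1u hU1
  -- the dictionary `χ₀ ↦ χ` (★ α-0) and its injectivity
  choose hk hk_ray hk_val using fun χ₀ : PontryaginDual ↥(IdeleClassGroup.normOne E) =>
    exists_heckeCharacter_of_normOne_character E (χ₀ : ↥(IdeleClassGroup.normOne E) →ₜ* Circle)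
  have hk_val' : ∀ (χ₀ : PontryaginDual ↥(IdeleClassGroup.normOne E)) (v : ↥(IdeleClassGroup.normOne E)) (x : ideleGroup E),
      (x : IdeleClassGroup E) = v → ((hk χ₀ x : ℂˣ) : ℂ) = ((χ₀ v : Circle) : ℂ) := fun χ₀ v x hx => by
    obtain ⟨v, hv⟩ := v
    subst hx
    exact hk_val χ₀ x hv
  have hk_inj : Function.Injective hk := fun χ₁ χ₂ h => by
    refine PontryaginDual.ext fun v => Circle.ext ?_
    obtain ⟨x, hx⟩ := QuotientGroup.mk_surjective (v : IdeleClassGroup E)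
    rw [← hk_val' χ₁ v x hx, ← hk_val' χ₂ v x hx, h]
  set ι : HeckeCharacter E → PontryaginDual ↥(IdeleClassGroup.normOne E) := Function.invFun hk with hιdef
  have hι : ∀ χ₀, ι (hk χ₀) = χ₀ := Function.leftInverse_invFun hk_inj
  refine ⟨s₀.image hk, fun χ => a₀ (ι χ), fun χ g => ∫ v, star (((ι χ) v : Circle) : ℂ) * Φ (v : IdeleClassGroup E) g ∂μC, fun χ hχ => ?_, fun g => ?_⟩
  · obtain ⟨χ₀, hχ₀, rfl⟩ := Finset.mem_image.1 hχ
    simp only [hι]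
    refine ⟨hk_ray χ₀, continuous_isotypicU μC hΦc χ₀, fun g k => ?_, fun β hβ g => ?_, fun β hβ h1 g => ?_, fun g hg => ?_, ⟨M, fun g => norm_isotypicU_le μC hM χ₀ g⟩⟩
    · simp_rw [kernel_mul_right hΦ (fun h => hψK h k)]
    · simp_rw [kernel_rational_mul hψU hψB hΦ _ hβ]
    · have hv₀ : ((firstEntryUnit hβ : ideleGroup E) : IdeleClassGroup E) ∈ IdeleClassGroup.normOne E := by
        rw [IdeleClassGroup.mem_normOne_iff, IdeleClassGroup.norm_mk, h1]
      simp_rw [kernel_borel_mul hψU hσm hσt hΦ _ hβ]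
      rw [hk_val' χ₀ ⟨_, hv₀⟩ (firstEntryUnit hβ) rfl]
      exact isotypicU_mul_normOne μC Φ χ₀ ⟨_, hv₀⟩ g
    · obtain ⟨v, hv⟩ := exists_kernel_ne_zero_of_isotypicU_ne_zero μC hg
      have h := norm_mul_borelHeight_mem_of_kernel_ne_zero hband hσ₀ hΦ hv
      rwa [IdeleClassGroup.mem_normOne_iff.1 v.2, one_mul] at h
  · rw [Finset.sum_image fun χ₁ _ χ₂ _ h => hk_inj h]
    simp only [hι]
    rw [← kernel_one_eq hσm hΦ g, ← OneMemClass.coe_one (IdeleClassGroup.normOne E)]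
    exact happrox g

end Summit.HodgeConjecture.HodgeConjecture.Cruxes.H413.K2E1NormOneTorusFamilyApproxU2
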